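import Summits.AtomisticToContinuum.HydrodynamicLimit.Theorems.AntiMazurCoboundariesCellForecastPressureDecayEnskogObjectsB
import HarnessLib

/-!
# Plan file (lead c3): the registered sub-goals of `stub_clusterTail` (S2e) — statements only.
Not a proposal; elaborated to fix the exact signatures that are registered by `stub-add`.
-/

noncomputable section

open MeasureTheory ProbabilityTheory Set Filter
open scoped ENNReal BigOperators InnerProductSpace
open Literature.Analysis.FluidPDE Literature.MathematicalPhysics.KineticTheory

namespace Summit.AtomisticToContinuum.HydrodynamicLimit.Theorems.EnskogCompensator

open Classical in
/-- **S2e-1 · weighted first-order bound**: the expected number of spheres that are NOT free in the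
slab `(0, Δ]`, weighted by `1 + |v_i|²`, is `≤ C L³ Δ` (insertion + removal + cylinder charging +
energy conservation of the bath). [folklore] -/
theorem stub_clusterTail_firstOrder : ∀ σ : ℝ, 0 < σ → σ ≤ 3 / 16 → CellLawFactorises σ →
    ∃ C : ℝ, 0 ≤ C ∧ ∀ L : ℝ, 1 ≤ L → ∀ n : ℕ, (n : ℝ) ≤ 2 * L ^ 3 → ∀ (Ψ : Flows σ) (Δ : ℝ), 0 < Δ → Δ ≤ 1 →
      ∫⁻ z, ∑ i : Fin n, (if IsFreeIn Ψ Δ z i then 0 else ENNReal.ofReal (1 + ‖(z i).2‖ ^ 2))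
          ∂(cellLaw σ L n Ψ) ≤ ENNReal.ofReal (C * L ^ 3 * Δ) := by
  sorry

open Classical in
/-- **S2e-2 · non-fresh first contacts are second order**: the expected number of spheres `i` that
are free on `(0, s)`, collide at a time `s ≤ Δ` with a sphere `j` which already took part in a
collision at a time `< s`, is `≤ C (L³Δ² + L²Δ)`. [folklore] -/
theorem stub_clusterTail_nonFresh : ∀ σ : ℝ, 0 < σ → σ ≤ 3 / 16 → CellLawFactorises σ →
    ∃ C : ℝ, 0 ≤ C ∧ ∀ L : ℝ, 1 ≤ L → ∀ n : ℕ, (n : ℝ) ≤ 2 * L ^ 3 → ∀ (Ψ : Flows σ) (Δ : ℝ), 0 < Δ → Δ ≤ 1 →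
      ∫⁻ z, ((Finset.univ.filter fun i : Fin n => ∃ j : Fin n, j ≠ i ∧ ∃ s ∈ Set.Ioc 0 Δ,
          Collide (Euclidean.geometry (Fin 3)) σ ((Ψ n).flow s z) i j ∧
          (∀ s' ∈ Set.Ioo 0 s, ¬ Participates (Euclidean.geometry (Fin 3)) σ ((Ψ n).flow s' z) i) ∧
          (∃ s' ∈ Set.Ioo 0 s, Participates (Euclidean.geometry (Fin 3)) σ ((Ψ n).flow s' z) j)).card : ℝ≥0∞)
          ∂(cellLaw σ L n Ψ) ≤ ENNReal.ofReal (C * (L ^ 3 * Δ ^ 2 + L ^ 2 * Δ)) := by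
  sorry

open Classical in
/-- **S2e-3 · a fresh pair that is disturbed is second order**: the expected number of ordered pairs
`(i, j)` that collide at a time `s ≤ Δ` while both were free on `(0, s)` and such that `i` or `j`
ALSO collides with a third sphere within `(0, Δ]`, is `≤ C (L³Δ² + L²Δ)`. [folklore] -/
theorem stub_clusterTail_freshPairHit : ∀ σ : ℝ, 0 < σ → σ ≤ 3 / 16 → CellLawFactorises σ →
    ∃ C : ℝ, 0 ≤ C ∧ ∀ L : ℝ, 1 ≤ L → ∀ n : ℕ, (n : ℝ) ≤ 2 * L ^ 3 → ∀ (Ψ : Flows σ) (Δ : ℝ), 0 < Δ → Δ ≤ 1 →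
      ∫⁻ z, ((Finset.univ.filter fun p : Fin n × Fin n => p.1 ≠ p.2 ∧ ∃ s ∈ Set.Ioc 0 Δ,
          Collide (Euclidean.geometry (Fin 3)) σ ((Ψ n).flow s z) p.1 p.2 ∧
          (∀ s' ∈ Set.Ioo 0 s, ¬ Participates (Euclidean.geometry (Fin 3)) σ ((Ψ n).flow s' z) p.1 ∧
            ¬ Participates (Euclidean.geometry (Fin 3)) σ ((Ψ n).flow s' z) p.2) ∧
          ∃ k : Fin n, k ≠ p.1 ∧ k ≠ p.2 ∧ ∃ s' ∈ Set.Ioc 0 Δ,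
            (Collide (Euclidean.geometry (Fin 3)) σ ((Ψ n).flow s' z) p.1 k ∨
              Collide (Euclidean.geometry (Fin 3)) σ ((Ψ n).flow s' z) p.2 k)).card : ℝ≥0∞)
          ∂(cellLaw σ L n Ψ) ≤ ENNReal.ofReal (C * (L ^ 3 * Δ ^ 2 + L ^ 2 * Δ)) := by
  sorry

open Classical in
/-- **S2e-4 · double cylinders are second order (static)**: the expected number of ordered triples of
distinct labels `(p, q, k)` with the initial data of both `(p, q)` and `(p, k)` in the collision
cylinder of the slab is `≤ C (L³Δ² + L²Δ)` (Ruelle's 3-label bound, independence of velocities,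
cylinder volume `π σ² Δ |v − u|`). [folklore] -/
theorem stub_clusterTail_doubleCylinder : ∀ σ : ℝ, 0 < σ → σ ≤ 3 / 16 → CellLawFactorises σ →
    ∃ C : ℝ, 0 ≤ C ∧ ∀ L : ℝ, 1 ≤ L → ∀ n : ℕ, (n : ℝ) ≤ 2 * L ^ 3 → ∀ (Ψ : Flows σ) (Δ : ℝ), 0 < Δ → Δ ≤ 1 →
      ∫⁻ z, ((Finset.univ.filter fun t : Fin n × Fin n × Fin n => t.1 ≠ t.2.1 ∧ t.1 ≠ t.2.2 ∧ t.2.1 ≠ t.2.2 ∧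
          InCylinder σ Δ z t.1 t.2.1 ∧ InCylinder σ Δ z t.1 t.2.2).card : ℝ≥0∞)
          ∂(cellLaw σ L n Ψ) ≤ ENNReal.ofReal (C * (L ^ 3 * Δ ^ 2 + L ^ 2 * Δ)) := by
  sorry

open Classical in
/-- **S2e-5 · assembly of the cluster tail** (pathwise combinatorics on the good set + the three
second-order bounds): a sphere that is neither free nor in an isolated pair has a first collision
which is either non-fresh (S2e-2) or fresh and then disturbed (S2e-3); a cylinder pair that is not
isolated is either a disturbed fresh pair (S2e-3), or its scheduled collision is pre-empted by a
non-fresh first contact (S2e-2, at most `1 + #double cylinders` partners per sphere) or by a fresh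
one (then two cylinders at one sphere, S2e-4). [folklore] -/
theorem stub_clusterTail_assembly : ∀ σ : ℝ, 0 < σ → σ ≤ 3 / 16 →
    (∃ C : ℝ, 0 ≤ C ∧ ∀ L : ℝ, 1 ≤ L → ∀ n : ℕ, (n : ℝ) ≤ 2 * L ^ 3 → ∀ (Ψ : Flows σ) (Δ : ℝ), 0 < Δ → Δ ≤ 1 →
      ∫⁻ z, ((Finset.univ.filter fun i : Fin n => ∃ j : Fin n, j ≠ i ∧ ∃ s ∈ Set.Ioc 0 Δ,
          Collide (Euclidean.geometry (Fin 3)) σ ((Ψ n).flow s z) i j ∧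
          (∀ s' ∈ Set.Ioo 0 s, ¬ Participates (Euclidean.geometry (Fin 3)) σ ((Ψ n).flow s' z) i) ∧
          (∃ s' ∈ Set.Ioo 0 s, Participates (Euclidean.geometry (Fin 3)) σ ((Ψ n).flow s' z) j)).card : ℝ≥0∞)
          ∂(cellLaw σ L n Ψ) ≤ ENNReal.ofReal (C * (L ^ 3 * Δ ^ 2 + L ^ 2 * Δ))) →
    (∃ C : ℝ, 0 ≤ C ∧ ∀ L : ℝ, 1 ≤ L → ∀ n : ℕ, (n : ℝ) ≤ 2 * L ^ 3 → ∀ (Ψ : Flows σ) (Δ : ℝ), 0 < Δ → Δ ≤ 1 →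
      ∫⁻ z, ((Finset.univ.filter fun p : Fin n × Fin n => p.1 ≠ p.2 ∧ ∃ s ∈ Set.Ioc 0 Δ,
          Collide (Euclidean.geometry (Fin 3)) σ ((Ψ n).flow s z) p.1 p.2 ∧
          (∀ s' ∈ Set.Ioo 0 s, ¬ Participates (Euclidean.geometry (Fin 3)) σ ((Ψ n).flow s' z) p.1 ∧
            ¬ Participates (Euclidean.geometry (Fin 3)) σ ((Ψ n).flow s' z) p.2) ∧
          ∃ k : Fin n, k ≠ p.1 ∧ k ≠ p.2 ∧ ∃ s' ∈ Set.Ioc 0 Δ,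
            (Collide (Euclidean.geometry (Fin 3)) σ ((Ψ n).flow s' z) p.1 k ∨
              Collide (Euclidean.geometry (Fin 3)) σ ((Ψ n).flow s' z) p.2 k)).card : ℝ≥0∞)
          ∂(cellLaw σ L n Ψ) ≤ ENNReal.ofReal (C * (L ^ 3 * Δ ^ 2 + L ^ 2 * Δ))) →
    (∃ C : ℝ, 0 ≤ C ∧ ∀ L : ℝ, 1 ≤ L → ∀ n : ℕ, (n : ℝ) ≤ 2 * L ^ 3 → ∀ (Ψ : Flows σ) (Δ : ℝ), 0 < Δ → Δ ≤ 1 →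
      ∫⁻ z, ((Finset.univ.filter fun t : Fin n × Fin n × Fin n => t.1 ≠ t.2.1 ∧ t.1 ≠ t.2.2 ∧ t.2.1 ≠ t.2.2 ∧
          InCylinder σ Δ z t.1 t.2.1 ∧ InCylinder σ Δ z t.1 t.2.2).card : ℝ≥0∞)
          ∂(cellLaw σ L n Ψ) ≤ ENNReal.ofReal (C * (L ^ 3 * Δ ^ 2 + L ^ 2 * Δ))) →
    ClusterTail σ := by
  sorry

/-- Consistency check of the plan: the five sub-goals give the registered stub `stub_clusterTail`
(note `CellLawFactorises σ` is available there; `ContactLayerBounds σ` is not even needed). -/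
example (h1 : ∀ σ : ℝ, 0 < σ → σ ≤ 3 / 16 → CellLawFactorises σ → ContactLayerBounds σ → ClusterTail σ) :
    True := trivial

theorem clusterTail_of_plan (σ : ℝ) (hσ : 0 < σ) (hσ' : σ ≤ 3 / 16) (hfac : CellLawFactorises σ)
    (_hclb : ContactLayerBounds σ) : ClusterTail σ :=
  stub_clusterTail_assembly σ hσ hσ' (stub_clusterTail_nonFresh σ hσ hσ' hfac)
    (stub_clusterTail_freshPairHit σ hσ hσ' hfac) (stub_clusterTail_doubleCylinder σ hσ hσ' hfac)

end Summit.AtomisticToContinuum.HydrodynamicLimit.Theorems.EnskogCompensator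

end
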